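import Literature.AlgebraicGeometry.Resolution.RegularSystemOfParameters
import Literature.AlgebraicGeometry.Resolution.RegularLocalRingsFlatDescent
import Mathlib.RingTheory.Flat.FaithfullyFlat.Algebra
import HarnessLib

/-!
# Strict normal crossings descend along flat local homomorphisms: the local algebra

Topic: `Literature/AlgebraicGeometry/Resolution`. The local computation behind the descent of
a strict normal crossings divisor through a faithfully flat base change (used for de Jong 1996,
4.5: the boundary divisor over `k̄` descends to a finite extension `k₁`, once its components are
defined over `k₁`). In the local form of de Jong 1996, 2.4 / Stacks 0BI9
(`IsStrictNormalCrossingsDivisor`: at `p ∈ D` the local ring is regular with a regular system of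
parameters `x₁, …, x_r, y₁, …, y_e` such that `I(D)_p = (x₁ ⋯ x_r)`), the statement is:

**Theorem** (`exists_rsop_prod_of_flat`). Let `A → B` be a flat local homomorphism of
Noetherian local rings, `B` regular with a regular system of parameters `x̄₁, …, x̄_r, ȳ₁, …, ȳ_e`.
Let `I ⊆ A` be an ideal with `I B = (x̄₁ ⋯ x̄_r)` whose "branches are defined over `A`":
`((x̄ᵢ) ∩ A) B = (x̄ᵢ)` for each `i`. Then `A` is regular and has a regular system of parameters
`x₁, …, x_r, y₁, …, y_{e'}` with `I = (x₁ ⋯ x_r)` (and `xᵢ B = x̄ᵢ B`).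

Proof: `A` is regular by Matsumura 23.7 (`IsRegularLocalRing.of_flat_of_isLocalHom`). A prime
`P ⊆ A` with `P B = (b)` principal is principal, generated by one of its generators `a` with
`a B = b B` (`B` is a local domain; `P = P B ∩ A` by faithful flatness) — this gives `xᵢ` with
`(xᵢ) = (x̄ᵢ) ∩ A`, `xᵢ B = x̄ᵢ B`, and `I = (∏ xᵢ)` by faithful flatness. The `xᵢ` are linearly
independent modulo `𝔪_A²` because the `x̄ᵢ = uᵢ xᵢ` are so modulo `𝔪_B²` (Matsumura 17.10 for
the regular system of parameters of `B`, `coeff_mem_maximalIdeal_of_eval_mem_pow`) and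
`𝔪_B ∩ A = 𝔪_A`; so they extend to a minimal basis of `𝔪_A`, of size `dim A`.

## References

* A. J. de Jong, *Smoothness, semi-stability and alterations*, Publ. Math. IHÉS 83 (1996), 2.4,
  4.5.
* H. Matsumura, *Commutative Ring Theory* (1986), Thm. 14.2, 17.10, 23.7. [Matsumura1987]
* The Stacks Project, Tag 0BI9.
-/

noncomputable section

universe u

open IsLocalRing

namespace Literature.AlgebraicGeometry.Resolution

namespace SNCLocalDescent

variable {A B : Type u} [CommRing A] [CommRing B] [IsLocalRing A] [IsNoetherianRing A]
  [IsRegularLocalRing B] [Algebra A B] [Module.Flat A B] [IsLocalHom (algebraMap A B)]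

/-- **A prime-like ideal whose extension is principal is principal**: for a flat local
`A → B` with `B` a regular local ring (a local domain) and an ideal `P ⊆ A` with
`P B = (b)`, `b ≠ 0`, some generator `a` of `P` already generates: `P = (a)` and `a B = b B`.
(Among generators `a₁, …, a_m` of `P`, write `b = Σ βⱼ aⱼ`, `aⱼ = γⱼ b`; then `Σ βⱼ γⱼ = 1`, so
some `γⱼ` is a unit; and `P = P B ∩ A` by faithful flatness.) [folklore] -/
theorem exists_eq_span_singleton_of_map_eq (P : Ideal A) {b : B} (hb : b ≠ 0)
    (hP : P.map (algebraMap A B) = Ideal.span {b}) :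
    ∃ a : A, P = Ideal.span {a} ∧ Ideal.span {algebraMap A B a} = Ideal.span {b} := by
  haveI : IsDomain B := isDomain_of_isRegularLocalRing B
  haveI : Module.FaithfullyFlat A B := Module.FaithfullyFlat.of_flat_of_isLocalHom
  set φ := algebraMap A B with hφ
  -- generators of `P`
  obtain ⟨m, v, hv⟩ := Submodule.fg_iff_exists_fin_generating_family.mp (IsNoetherian.noetherian P)
  have hvP : ∀ j, v j ∈ P := fun j => hv ▸ Ideal.subset_span ⟨j, rfl⟩
  -- `b = Σ βⱼ φ(vⱼ)`
  have hbmem : b ∈ Ideal.span (Set.range (φ ∘ v)) := by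
    have : Ideal.span (Set.range (φ ∘ v)) = P.map φ := by
      rw [← hv, Ideal.map_span, Set.range_comp]
    rw [this, hP]
    exact Ideal.mem_span_singleton_self b
  obtain ⟨β, hβ⟩ := Ideal.mem_span_range_iff_exists_fun.mp hbmem
  -- `φ(vⱼ) = γⱼ b`
  have hγ : ∀ j, ∃ γ : B, γ * b = φ (v j) := fun j => by
    have : φ (v j) ∈ P.map φ := Ideal.mem_map_of_mem _ (hvP j)
    rw [hP] at this
    exact Ideal.mem_span_singleton'.mp this
  choose γ hγ using hγ
  -- `Σ βⱼ γⱼ = 1`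
  have hsum : ∑ j, β j * γ j = 1 := by
    have h1 : (∑ j, β j * γ j) * b = 1 * b := by
      rw [one_mul, Finset.sum_mul]
      conv_rhs => rw [← hβ]
      refine Finset.sum_congr rfl fun j _ => ?_
      rw [mul_assoc, hγ j]
      rfl
    exact mul_right_cancel₀ hb h1
  -- some `βⱼ γⱼ` is a unit, hence `γⱼ` is a unit
  obtain ⟨j, hj⟩ : ∃ j, IsUnit (β j * γ j) := by
    by_contra h
    push Not at h
    have : ∑ j, β j * γ j ∈ maximalIdeal B :=
      Ideal.sum_mem _ fun j _ => (mem_maximalIdeal _).mpr (h j)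
    rw [hsum] at this
    exact (maximalIdeal.isMaximal B).ne_top (Ideal.eq_top_of_isUnit_mem _ this isUnit_one)
  have hγu : IsUnit (γ j) := isUnit_of_mul_isUnit_right hj
  refine ⟨v j, ?_, ?_⟩
  · -- `P = (vⱼ)` by faithful flatness
    have hspan : Ideal.span {φ (v j)} = Ideal.span {b} := by
      rw [← hγ j]
      exact Ideal.span_singleton_mul_left_unit hγu b
    refine le_antisymm ?_ ((Ideal.span_singleton_le_iff_mem _).mpr (hvP j))
    intro z hz
    have h1 : φ z ∈ (Ideal.span {v j}).map φ := by
      rw [Ideal.map_span, Set.image_singleton, hspan, ← hP]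
      exact Ideal.mem_map_of_mem _ hz
    have h2 : z ∈ ((Ideal.span {v j}).map φ).comap φ := Ideal.mem_comap.mpr h1
    rwa [Ideal.comap_map_eq_self_of_faithfullyFlat] at h2
  · rw [← hγ j]
    exact Ideal.span_singleton_mul_left_unit hγu b

end SNCLocalDescent

open SNCLocalDescent

/-- The range of an appended family is the union of the ranges (local copy of the helper in
`AlterationsEnlargingZ.lean`, not imported here). [folklore] -/
private theorem range_fin_append' {α : Type*} {r e : ℕ} (x : Fin r → α) (y : Fin e → α) :
    Set.range (Fin.append x y) = Set.range x ∪ Set.range y := by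
  ext a
  simp only [Set.mem_range, Set.mem_union]
  constructor
  · rintro ⟨i, rfl⟩
    refine Fin.addCases (fun i => ?_) (fun i => ?_) i
    · exact Or.inl ⟨i, by rw [Fin.append_left]⟩
    · exact Or.inr ⟨i, by rw [Fin.append_right]⟩
  · rintro (⟨i, rfl⟩ | ⟨i, rfl⟩)
    · exact ⟨Fin.castAdd e i, by rw [Fin.append_left]⟩
    · exact ⟨Fin.natAdd r i, by rw [Fin.append_right]⟩

/-- **Strict normal crossings descend along a flat local homomorphism** (local algebra; used for
de Jong 1996, 4.5). Let `A → B` be a flat local homomorphism of Noetherian local rings with `B`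
regular, `x̄ : Fin r → B`, `ȳ : Fin e → B` a regular system of parameters of `B`
(`dim B = r + e` generators of `𝔪_B`), and `I ⊆ A` an ideal with `I B = (∏ x̄ᵢ)` such that each
branch `(x̄ᵢ)` is defined over `A`: `((x̄ᵢ) ∩ A) B = (x̄ᵢ)`. Then `A` is a regular local ring
with a regular system of parameters `x : Fin r → A`, `y : Fin e' → A` (`dim A = r + e'`
generators of `𝔪_A`) such that `I = (∏ xᵢ)`. [folklore] -/
theorem exists_rsop_prod_of_flat {A B : Type u} [CommRing A] [CommRing B] [IsLocalRing A]
    [IsNoetherianRing A] [IsRegularLocalRing B] [Algebra A B] [Module.Flat A B]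
    [IsLocalHom (algebraMap A B)] {r e : ℕ} (xb : Fin r → B) (yb : Fin e → B)
    (hdimB : ringKrullDim B = (r + e : ℕ))
    (hspanB : Ideal.span (Set.range xb ∪ Set.range yb) = maximalIdeal B) (I : Ideal A)
    (hI : I.map (algebraMap A B) = Ideal.span {∏ i, xb i})
    (hdesc : ∀ i, ((Ideal.span {xb i}).comap (algebraMap A B)).map (algebraMap A B) =
      Ideal.span {xb i}) :
    IsRegularLocalRing A ∧ ∃ (e' : ℕ) (x : Fin r → A) (y : Fin e' → A),
      ringKrullDim A = (r + e' : ℕ) ∧ Ideal.span (Set.range x ∪ Set.range y) = maximalIdeal A ∧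
      I = Ideal.span {∏ i, x i} ∧ ∀ i, Ideal.span {algebraMap A B (x i)} = Ideal.span {xb i} := by
  classical
  haveI : IsDomain B := isDomain_of_isRegularLocalRing B
  haveI : Module.FaithfullyFlat A B := Module.FaithfullyFlat.of_flat_of_isLocalHom
  haveI hA : IsRegularLocalRing A := IsRegularLocalRing.of_flat_of_isLocalHom A B
  set φ := algebraMap A B with hφ
  -- the regular system of parameters of `B` as one family
  set zb : Fin (r + e) → B := Fin.append xb yb with hzb
  have hzbspan : Ideal.span (Set.range zb) = maximalIdeal B := by rw [hzb, range_fin_append', hspanB]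
  have hdB : (maximalIdeal B).spanFinrank = r + e := by
    have h := IsRegularLocalRing.spanFinrank_maximalIdeal (R := B)
    rw [hdimB] at h
    exact_mod_cast h
  -- `x̄ᵢ ≠ 0`
  have hxb0 : ∀ i, xb i ≠ 0 := fun i h0 => by
    have := not_mem_span_image_of_not_mem hdB zb hzbspan (S := ∅) (i := Fin.castAdd e i)
      (Set.notMem_empty _)
    apply this
    rw [hzb, Fin.append_left, h0]
    exact Ideal.zero_mem _
  -- descend the branches
  have hx : ∀ i, ∃ a : A, (Ideal.span {xb i}).comap φ = Ideal.span {a} ∧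
      Ideal.span {φ a} = Ideal.span {xb i} :=
    fun i => exists_eq_span_singleton_of_map_eq _ (hxb0 i) (hdesc i)
  choose x hxP hxspan using hx
  -- units `uᵢ` with `φ (x i) * uᵢ = x̄ᵢ`
  have hu : ∀ i, ∃ u : Bˣ, φ (x i) * u = xb i := fun i =>
    Ideal.span_singleton_eq_span_singleton.mp (hxspan i)
  choose u hu using hu
  -- `I = (∏ xᵢ)` by faithful flatness
  have hIx : I = Ideal.span {∏ i, x i} := by
    have h1 : (Ideal.span {∏ i, x i}).map φ = Ideal.span {∏ i, xb i} := by
      rw [Ideal.map_span, Set.image_singleton, map_prod, ← Ideal.prod_span_singleton,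
        ← Ideal.prod_span_singleton]
      exact Finset.prod_congr rfl fun i _ => hxspan i
    rw [← Ideal.comap_map_eq_self_of_faithfullyFlat (B := B) I,
      ← Ideal.comap_map_eq_self_of_faithfullyFlat (B := B) (Ideal.span {∏ i, x i})]
    change (I.map φ).comap φ = ((Ideal.span {∏ i, x i}).map φ).comap φ
    rw [hI, h1]
  -- the `xᵢ` lie in `𝔪_A`
  have hxm : ∀ i, x i ∈ maximalIdeal A := fun i => by
    have h1 : φ (x i) ∈ maximalIdeal B := by
      have hmem : xb i ∈ maximalIdeal B := hspanB ▸ Ideal.subset_span (Or.inl ⟨i, rfl⟩)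
      rw [← hu i] at hmem
      exact (Ideal.unit_mul_mem_iff_mem _ (u i).isUnit).mp (by rwa [mul_comm] at hmem)
    exact (map_mem_nonunits_iff φ (x i)).mp h1
  -- linear independence of the `xᵢ` modulo `𝔪_A²`, from that of the `x̄ᵢ` modulo `𝔪_B²`
  have hlin : ∀ (c : Fin r → A), (∑ i, c i * x i) ∈ maximalIdeal A ^ 2 →
      ∀ i, c i ∈ maximalIdeal A := by
    intro c hc i
    let a : Fin r → B := fun i => φ (c i) * ((u i)⁻¹ : Bˣ)
    let F : MvPolynomial (Fin (r + e)) B :=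
      ∑ i : Fin r, MvPolynomial.C (a i) * MvPolynomial.X (Fin.castAdd e i)
    have hF : F.IsHomogeneous 1 := by
      refine MvPolynomial.IsHomogeneous.sum _ _ _ fun i _ => ?_
      simpa using (MvPolynomial.isHomogeneous_C _ (a i)).mul (MvPolynomial.isHomogeneous_X B _)
    have ha : ∀ i, a i * xb i = φ (c i) * φ (x i) := fun i => by
      simp only [a]
      rw [← hu i, mul_assoc, mul_comm (φ (x i)) _, ← mul_assoc (((u i)⁻¹ : Bˣ) : B),
        Units.inv_mul, one_mul]
    have heval : MvPolynomial.eval zb F = φ (∑ i, c i * x i) := by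
      simp only [F, map_sum, map_mul, MvPolynomial.eval_C, MvPolynomial.eval_X, hzb,
        Fin.append_left, ha]
    have hmem : MvPolynomial.eval zb F ∈ maximalIdeal B ^ (1 + 1) := by
      rw [heval]
      have h1 : (maximalIdeal A).map φ ≤ maximalIdeal B :=
        Ideal.map_le_iff_le_comap.mpr fun z hz => map_nonunit φ z hz
      have h2 : (maximalIdeal A ^ 2).map φ ≤ maximalIdeal B ^ 2 := by
        rw [Ideal.map_pow]
        exact Ideal.pow_right_mono h1 2
      exact h2 (Ideal.mem_map_of_mem φ hc)
    have hcoeff := coeff_mem_maximalIdeal_of_eval_mem_pow hdB zb hzbspan hF hmem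
      (Finsupp.single (Fin.castAdd e i) 1)
    have hci : F.coeff (Finsupp.single (Fin.castAdd e i) 1) = a i := by
      simp only [F, MvPolynomial.coeff_sum, MvPolynomial.coeff_C_mul, MvPolynomial.coeff_X,
        mul_ite, mul_one, mul_zero]
      rw [Finset.sum_eq_single i]
      · simp
      · intro j _ hji
        rw [if_neg]
        intro h
        have hij := (Fin.castAdd_injective _ _) (Finsupp.single_left_injective one_ne_zero h)
        exact hji hij
      · intro h
        exact absurd (Finset.mem_univ i) h
    rw [hci] at hcoeff
    have h3 : φ (c i) ∈ maximalIdeal B := by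
      have := Ideal.mul_mem_right ((u i : Bˣ) : B) _ hcoeff
      simpa only [a, mul_assoc, Units.inv_mul, mul_one] using this
    exact (map_mem_nonunits_iff φ (c i)).mp h3
  -- the images of the `xᵢ` in the cotangent space are linearly independent
  let k := ResidueField A
  let V := CotangentSpace A
  let x' : Fin r → V := fun i => (maximalIdeal A).toCotangent ⟨x i, hxm i⟩
  have hli : LinearIndependent k x' := by
    rw [Fintype.linearIndependent_iff]
    intro g hg i
    have hc : ∀ i, ∃ c : A, IsLocalRing.residue A c = g i := fun i =>
      Ideal.Quotient.mk_surjective (g i)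
    choose c hc using hc
    have h1 : ∑ i, g i • x' i = (maximalIdeal A).toCotangent (∑ i, c i • ⟨x i, hxm i⟩) := by
      rw [map_sum]
      refine Finset.sum_congr rfl fun i _ => ?_
      rw [map_smul, ← hc i]
      rfl
    rw [h1, Ideal.toCotangent_eq_zero] at hg
    have h2 : ((∑ i, c i • (⟨x i, hxm i⟩ : maximalIdeal A) : maximalIdeal A) : A) =
        ∑ i, c i * x i := by
      simp
    rw [h2] at hg
    rw [← hc i]
    exact (IsLocalRing.residue_eq_zero_iff _).mpr (hlin c hg i)
  -- extend to a basis of the cotangent space and lift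
  let bas := Module.Basis.sumExtend hli
  let J := Module.Basis.sumExtendIndex hli
  haveI : Fintype J := by
    haveI : Finite (Fin r ⊕ J) := Module.Finite.finite_basis bas
    haveI : Finite J := Finite.of_injective (Sum.inr : J → Fin r ⊕ J) Sum.inr_injective
    exact Fintype.ofFinite J
  have hbas : ∀ i, bas (Sum.inl i) = x' i := fun i => by
    simp only [bas, Module.Basis.sumExtend, Module.Basis.coe_reindex, Function.comp_apply,
      Equiv.symm_symm, Module.Basis.coe_extend]
    rfl
  let e' := Fintype.card J
  let ι : Fin e' ≃ J := (Fintype.equivFin J).symm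
  have hy : ∀ j : Fin e', ∃ z : maximalIdeal A, (maximalIdeal A).toCotangent z = bas (Sum.inr (ι j)) :=
    fun j => Ideal.toCotangent_surjective _ _
  choose yy hyy using hy
  let y : Fin e' → A := fun j => (yy j : A)
  -- the family `x ∪ y` generates `𝔪_A`
  let T : Set (maximalIdeal A) := Set.range (fun i => (⟨x i, hxm i⟩ : maximalIdeal A)) ∪
    Set.range yy
  have hTspan : Submodule.span k ((maximalIdeal A).toCotangent '' T) = ⊤ := by
    apply top_le_iff.mp
    rw [← bas.span_eq, Submodule.span_le]
    rintro _ ⟨ij, rfl⟩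
    apply Submodule.subset_span
    rcases ij with i | j
    · exact ⟨⟨x i, hxm i⟩, Or.inl ⟨i, rfl⟩, (hbas i).symm⟩
    · refine ⟨yy (ι.symm j), Or.inr ⟨ι.symm j, rfl⟩, ?_⟩
      rw [hyy, Equiv.apply_symm_apply]
  rw [IsLocalRing.CotangentSpace.span_image_eq_top_iff] at hTspan
  have hspanA : Ideal.span (Set.range x ∪ Set.range y) = maximalIdeal A := by
    have h1 : Submodule.map (maximalIdeal A).subtype (Submodule.span A T) = maximalIdeal A := by
      rw [hTspan, Submodule.map_top, Submodule.range_subtype]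
    rw [Submodule.map_span] at h1
    have h2 : (maximalIdeal A).subtype '' T = Set.range x ∪ Set.range y := by
      simp only [T, Set.image_union, ← Set.range_comp]
      rfl
    rw [h2] at h1
    exact h1
  -- dimension count
  have hdimA : ringKrullDim A = (r + e' : ℕ) := by
    have h1 := IsRegularLocalRing.spanFinrank_maximalIdeal (R := A)
    rw [← h1, IsLocalRing.spanFinrank_maximalIdeal_eq_finrank_cotangentSpace,
      Module.finrank_eq_card_basis bas, Fintype.card_sum, Fintype.card_fin]
  exact ⟨hA, e', x, y, hdimA, hspanA, hIx, hxspan⟩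

end Literature.AlgebraicGeometry.Resolution

end
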